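import Mathlib.MeasureTheory.Integral.DominatedConvergence
import Mathlib.Probability.Martingale.Basic
import HarnessLib

/-!
# Bounded pointwise limits of martingales are martingales

Topic `Probability/Process`; theorems only. A classical closure property used in the
"`x₁ → 0+`" / "let the level tend to the exit value" limits of Lawler (2005), proof of Prop. 1.21
(first the bounded martingales `M_t := φ₀(X_{t∧σ})` for `0 < x₁ < x < x₂`, then the limits
`x₁ → 0+`, `x₂ → ∞`): if `Mⁿ` are martingales of a filtration `𝓕` on a finite measure space,
`|Mⁿ_i| ≤ C_i`, and `Mⁿ_i → X_i` almost surely for every index `i`, then the (strongly adapted)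
limit `X` is a martingale (`Literature.Probability.Process.martingale_of_tendsto_of_abs_le`): set
integrals over `𝓕_s`-events pass to the limit by dominated convergence, and conditional
expectations are characterised by set integrals (Mathlib
`ae_eq_condExp_of_forall_setIntegral_eq`). When the convergence holds at *every* `ω`, the
limit is automatically strongly adapted (`martingale_of_tendsto_of_abs_le'`, Mathlib
`stronglyMeasurable_of_tendsto`). No path regularity and no usual conditions are involved.

## References

* D. Revuz, M. Yor, *Continuous Martingales and Brownian Motion* (3rd ed., 1999), Ch. II, §1
  (martingales; closure under `L¹`-limits of the defining identity `E[X_t 1_A] = E[X_s 1_A]`).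
* G. F. Lawler, *Conformally Invariant Processes in the Plane* (2005), §1.10, proof of
  Prop. 1.21 (limits `x₁ → 0+`, `x₂ → ∞` of the bounded martingales `φ₀(X_{t∧σ})`).
-/

noncomputable section

open MeasureTheory Filter Topology

namespace Literature.Probability.Process

variable {Ω ι : Type*} {m : MeasurableSpace Ω} [Preorder ι] {𝓕 : Filtration ι m}
  {P : Measure Ω}

/-- **Bounded a.s. limits of martingales are martingales.** Let `Mⁿ` be `𝓕`-martingales on a
finite measure space with `|Mⁿ_i(ω)| ≤ C_i` for all `n, i, ω`, and suppose `Mⁿ_i → X_i` almost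
surely for every index `i`, where `X` is strongly adapted. Then `X` is a martingale: for `s ≤ i`
and `A ∈ 𝓕_s`, `∫_A X_s = lim ∫_A Mⁿ_s = lim ∫_A Mⁿ_i = ∫_A X_i` by dominated convergence.
Revuz–Yor (1999), Ch. II §1; Lawler (2005), proof of Prop. 1.21 (the limits `x₁ → 0+`).
[cite: RevuzYor1999, Ch. II §1] -/
theorem martingale_of_tendsto_of_abs_le [IsFiniteMeasure P] {M : ℕ → ι → Ω → ℝ} {X : ι → Ω → ℝ}
    (hM : ∀ n, Martingale (M n) 𝓕 P) {C : ι → ℝ} (hbdd : ∀ n i ω, |M n i ω| ≤ C i)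
    (hlim : ∀ i, ∀ᵐ ω ∂P, Tendsto (fun n ↦ M n i ω) atTop (𝓝 (X i ω)))
    (hadapt : StronglyAdapted 𝓕 X) : Martingale X 𝓕 P := by
  have hmeasM : ∀ n i, AEStronglyMeasurable (M n i) P := fun n i ↦
    (((hM n).stronglyMeasurable i).mono (𝓕.le i)).aestronglyMeasurable
  have hmeasX : ∀ i, StronglyMeasurable (X i) := fun i ↦ (hadapt i).mono (𝓕.le i)
  -- the limit inherits the bound almost surely
  have hXbdd : ∀ i, ∀ᵐ ω ∂P, |X i ω| ≤ C i := by
    intro i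
    filter_upwards [hlim i] with ω hω
    exact le_of_tendsto ((continuous_abs.tendsto _).comp hω)
      (Eventually.of_forall fun n ↦ hbdd n i ω)
  have hintX : ∀ i, Integrable (X i) P := fun i ↦
    (integrable_const (C i)).mono' (hmeasX i).aestronglyMeasurable
      ((hXbdd i).mono fun ω hω ↦ by rwa [Real.norm_eq_abs])
  -- set integrals of `X` are limits of those of `M n`
  have hset : ∀ (i : ι) {A : Set Ω}, MeasurableSet A →
      Tendsto (fun n ↦ ∫ ω in A, M n i ω ∂P) atTop (𝓝 (∫ ω in A, X i ω ∂P)) := by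
    intro i A _
    refine tendsto_integral_of_dominated_convergence (fun _ ↦ C i) (fun n ↦ (hmeasM n i).restrict)
      (integrable_const (C i)) (fun n ↦ ae_of_all _ fun ω ↦ ?_) (ae_restrict_of_ae (hlim i))
    rw [Real.norm_eq_abs]
    exact hbdd n i ω
  refine ⟨hadapt, fun s t hst ↦ ?_⟩
  symm
  refine ae_eq_condExp_of_forall_setIntegral_eq (𝓕.le s) (hintX t)
    (fun A _ _ ↦ (hintX s).integrableOn) (fun A hA _ ↦ ?_) (hadapt s).aestronglyMeasurable
  have hA' : MeasurableSet A := 𝓕.le s A hA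
  have h1 := hset s hA'
  have h2 := hset t hA'
  have heq : (fun n ↦ ∫ ω in A, M n s ω ∂P) = fun n ↦ ∫ ω in A, M n t ω ∂P :=
    funext fun n ↦ (hM n).setIntegral_eq hst hA
  rw [heq] at h1
  exact tendsto_nhds_unique h1 h2

/-- **Bounded pointwise limits of martingales are martingales** (convergence at every `ω`): the
limit of a sequence of `𝓕_i`-strongly measurable functions is `𝓕_i`-strongly measurable, so the
adaptedness hypothesis of `martingale_of_tendsto_of_abs_le` is automatic.
Revuz–Yor (1999), Ch. II §1; Lawler (2005), proof of Prop. 1.21. [cite: RevuzYor1999, Ch. II §1] -/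
theorem martingale_of_tendsto_of_abs_le' [IsFiniteMeasure P] {M : ℕ → ι → Ω → ℝ}
    {X : ι → Ω → ℝ} (hM : ∀ n, Martingale (M n) 𝓕 P) {C : ι → ℝ}
    (hbdd : ∀ n i ω, |M n i ω| ≤ C i)
    (hlim : ∀ i ω, Tendsto (fun n ↦ M n i ω) atTop (𝓝 (X i ω))) : Martingale X 𝓕 P := by
  have hadapt : StronglyAdapted 𝓕 X := fun i ↦
    stronglyMeasurable_of_tendsto (f := fun n ↦ M n i) atTop (fun n ↦ (hM n).stronglyMeasurable i)
      (tendsto_pi_nhds.2 (hlim i))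
  exact martingale_of_tendsto_of_abs_le hM hbdd (fun i ↦ ae_of_all _ (hlim i)) hadapt

end Literature.Probability.Process
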